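import Mathlib
import Summits.ValiantsHypothesis.ValiantsHypothesis.Theorems.NewtonUnitEquationsNewtonTauWeakCornerDefs
import Summits.ValiantsHypothesis.ValiantsHypothesis.Theorems.NewtonUnitEquationsNewtonTauWeakVdpDefs

/-!
# `NewtonTauWeak` (stmt-ValiantsHypothesis-5904), line `binomial-normal-form`: objects of the GLOBAL
# assembly of the fixed-`K` coincidence rung (`K = 3`, no short 2-vs-1 relations)

Route-posited objects (D-0016 `…Defs` file) for the registered sub-stub `fixedKCoincidence_t2_K3` of the
crux `Summit.ValiantsHypothesis.ValiantsHypothesis.Theses.NewtonUnitEquations.NewtonTauWeak` (KPTT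
arXiv:1308.2286 Conj. 1 at `t = 2`, `K = 3` products over a common exponent list without short 2-vs-1
direction relations), following `Cruxes/NewtonTauWeak/Lines/binomial-normal-form-ltc.md` §2–§5 (lead c2:
flip identity per sign pattern, corner localisation, ray lemma / corner rigidity / two-plus-one case,
count of initial exponents):

* the Laurent ring `L = ℂ[ℤ²]` (Mathlib's `AddMonoidAlgebra ℂ (Fin 2 → ℤ)`) with the embedding
  `ιL : ℂ[X,Y] → L`, strict `w`-initial exponents `IsInit`, evaluation of a univariate polynomial on a
  Laurent monomial `evalRay`, and separated products `sepL E Q = Π_e Q_e(X^{E_e})` (whose coefficients are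
  the fibre sums of `…CornerDefs.lean`);
* lattice multiplicity / primitive vector `mult`, `prim` of an exponent, the local `ray` of an exponent
  for a sign pattern `S ⊆ [N]` (exponents in `S` are flipped), the ray set `rays`, the multiplicity
  `rayMult` carried by a ray, the sign pattern `posSet w d` of a weight;
* per product and sign pattern: the flipped binomial coefficient `flipCoef`, the univariate RAY POLYNOMIAL
  `rayPoly` of a ray, the CORNER `corner` (top exponent) and the CORNER COEFFICIENT `gam`.

Everything is a definition [folklore]; first users: `Theorems/NewtonUnitEquationsNewtonTauWeakK3Paper*.lean`.
-/

-- the namespace mandated for this Theorems file repeats the component `ValiantsHypothesis`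
set_option linter.dupNamespace false

noncomputable section

open scoped BigOperators Polynomial
open Summit.ValiantsHypothesis.ValiantsHypothesis.Theorems.NewtonTauWeakCorner (wt)
open Summit.ValiantsHypothesis.ValiantsHypothesis.Theorems.NewtonTauWeakVdp (wdeg)

namespace Summit.ValiantsHypothesis.ValiantsHypothesis.Theorems.NewtonTauWeakK3Paper

/-! ## The Laurent ring `ℂ[ℤ²]` -/

/-- The Laurent ring `ℂ[ℤ²] = ℂ[X^{±1}, Y^{±1}]` in which corner localisations of bivariate polynomials live
(the group algebra of `ℤ²`). [folklore] -/
abbrev L : Type := AddMonoidAlgebra ℂ (Fin 2 → ℤ)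

/-- The embedding of exponents `ℕ² → ℤ²` (an additive monoid homomorphism). [folklore] -/
def zOf : (Fin 2 →₀ ℕ) →+ (Fin 2 → ℤ) where
  toFun e := fun i => ((e i : ℕ) : ℤ)
  map_zero' := by funext i; simp
  map_add' a b := by funext i; simp

/-- Coordinates of the embedded exponent (registered anchor of this Defs file). [folklore] -/
theorem k3p_zOf_apply (e : Fin 2 →₀ ℕ) (i : Fin 2) : zOf e i = ((e i : ℕ) : ℤ) := rfl

/-- The ring embedding `ℂ[X,Y] → ℂ[ℤ²]` induced by `zOf`. [folklore] -/
def ιL : MvPolynomial (Fin 2) ℂ →+* L := AddMonoidAlgebra.mapDomainRingHom ℂ zOf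

/-- `v` is THE strict `w`-initial exponent of `F ∈ ℂ[ℤ²]`: it lies in the support and is strictly lighter
(for the real weight `⟨w,·⟩`) than every other support exponent. [folklore] -/
def IsInit (w : Fin 2 → ℝ) (F : L) (v : Fin 2 → ℤ) : Prop :=
  v ∈ F.coeff.support ∧ ∀ z ∈ F.coeff.support, z ≠ v → wt w v < wt w z

/-- Evaluation of a univariate polynomial on the Laurent monomial `X^r`: `P ↦ P(X^r) ∈ ℂ[ℤ²]`
(a ring homomorphism). [folklore] -/
def evalRay (r : Fin 2 → ℤ) : ℂ[X] →+* L :=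
  Polynomial.eval₂RingHom (AddMonoidAlgebra.singleZeroRingHom) (AddMonoidAlgebra.single r 1)

/-- The SEPARATED PRODUCT `Π_e Q_e(X^{E_e}) ∈ ℂ[ℤ²]` of univariate polynomials along a list of directions
(its coefficient at `z` is the fibre sum `Σ_{push E n = z} sepCoeff Q n` of `…CornerDefs`). [folklore] -/
def sepL {s : ℕ} (E : Fin s → Fin 2 → ℤ) (Q : Fin s → ℂ[X]) : L := ∏ e, evalRay (E e) (Q e)

/-! ## Exponents: multiplicity, primitive vectors, local rays, sign patterns -/

/-- The lattice multiplicity `gcd(a₀, a₁)` of an exponent `a ∈ ℕ²` (`0` iff `a = 0`). [folklore] -/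
def mult (a : Fin 2 →₀ ℕ) : ℕ := Nat.gcd (a 0) (a 1)

/-- The primitive vector `a / gcd(a₀, a₁) ∈ ℤ²` of an exponent `a ∈ ℕ²` (`0` for `a = 0`), so that
`a = mult a • prim a`. [folklore] -/
def prim (a : Fin 2 →₀ ℕ) : Fin 2 → ℤ := fun i => ((a i / mult a : ℕ) : ℤ)

/-- The LOCAL RAY of the `j`-th exponent for the sign pattern `S` (the set of indices of exponents of
positive weight): `-prim d_j` if `j ∈ S` (flipped), `prim d_j` otherwise; for the pattern of a generic
weight `w` every local ray has negative `w`-weight. [folklore] -/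
def ray {N : ℕ} (d : Fin N → (Fin 2 →₀ ℕ)) (S : Finset (Fin N)) (j : Fin N) : Fin 2 → ℤ :=
  if j ∈ S then -prim (d j) else prim (d j)

/-- The set of local rays of the nonzero exponents for the sign pattern `S`. [folklore] -/
def rays {N : ℕ} (d : Fin N → (Fin 2 →₀ ℕ)) (S : Finset (Fin N)) : Finset (Fin 2 → ℤ) :=
  (Finset.univ.filter fun j => d j ≠ 0).image (ray d S)

/-- The total multiplicity `M_r = Σ_{d_j ≠ 0, ray_j = r} mult(d_j)` carried by the local ray `r` (it bounds
the degree of every ray polynomial on `r`, hence every corner order, which is what the "no short 2-vs-1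
relation" hypothesis of `fixedKCoincidence_t2_K3` quantifies over). [folklore] -/
def rayMult {N : ℕ} (d : Fin N → (Fin 2 →₀ ℕ)) (S : Finset (Fin N)) (r : Fin 2 → ℤ) : ℕ :=
  ∑ j ∈ Finset.univ.filter (fun j => d j ≠ 0 ∧ ray d S j = r), mult (d j)

/-- The SIGN PATTERN of a real weight: the indices of the exponents of positive weight. [folklore] -/
def posSet {N : ℕ} (w : Fin 2 → ℝ) (d : Fin N → (Fin 2 →₀ ℕ)) : Finset (Fin N) :=
  Finset.univ.filter fun j => 0 < wdeg w (d j)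

/-! ## Products of binomials: flipped coefficients, ray polynomials, corners -/

/-- The flipped coefficient of the `j`-th binomial `1 - ρ_j X^{d_j}` of a product for the pattern `S`:
`-ρ_j⁻¹` if `j ∈ S` (the factor is rewritten `-ρ_j X^{d_j}(1 - ρ_j⁻¹ X^{-d_j})`), `-ρ_j` otherwise.
[folklore] -/
def flipCoef {N : ℕ} (ρl : Fin N → ℂ) (S : Finset (Fin N)) (j : Fin N) : ℂ :=
  if j ∈ S then -(ρl j)⁻¹ else -(ρl j)

/-- The univariate RAY POLYNOMIAL of a product (coefficient row `ρl`) on the local ray `r` for the pattern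
`S`: the product of the flipped binomials `1 + flipCoef_j · s^{mult d_j}` over the ALIVE exponents
(`d_j ≠ 0`, `ρ_j ≠ 0`) whose local ray is `r`; constant term `1`, degree `≤ rayMult d S r`. [folklore] -/
def rayPoly {N : ℕ} (ρl : Fin N → ℂ) (d : Fin N → (Fin 2 →₀ ℕ)) (S : Finset (Fin N)) (r : Fin 2 → ℤ) : ℂ[X] :=
  ∏ j ∈ Finset.univ.filter (fun j => d j ≠ 0 ∧ ρl j ≠ 0 ∧ ray d S j = r),
    (1 + Polynomial.C (flipCoef ρl S j) * Polynomial.X ^ mult (d j))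

/-- The CORNER of a product for the pattern `S`: the sum of its alive exponents lying in `S` (for the
pattern of a generic weight this is the strict top exponent of the product). [folklore] -/
def corner {N : ℕ} (ρl : Fin N → ℂ) (d : Fin N → (Fin 2 →₀ ℕ)) (S : Finset (Fin N)) : Fin 2 →₀ ℕ :=
  ∑ j ∈ Finset.univ.filter (fun j => j ∈ S ∧ d j ≠ 0 ∧ ρl j ≠ 0), d j

/-- The CORNER COEFFICIENT of a product for the pattern `S`: the constants `1 - ρ_j` of the degenerate
factors (`d_j = 0`) times the leading coefficients `-ρ_j` of the flipped alive binomials. [folklore] -/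
def gam {N : ℕ} (ρl : Fin N → ℂ) (d : Fin N → (Fin 2 →₀ ℕ)) (S : Finset (Fin N)) : ℂ :=
  (∏ j ∈ Finset.univ.filter (fun j => d j = 0), (1 - ρl j)) *
    ∏ j ∈ Finset.univ.filter (fun j => j ∈ S ∧ d j ≠ 0 ∧ ρl j ≠ 0), (-ρl j)

end Summit.ValiantsHypothesis.ValiantsHypothesis.Theorems.NewtonTauWeakK3Paper

end
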